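import Literature.NumberTheory.Sieve.FriedlanderIwaniecPrimesLemma31Smoothing
import Literature.NumberTheory.Sieve.FriedlanderIwaniecPrimesLemma31Oscillatory
import HarnessLib

/-!
# Friedlander–Iwaniec, *The polynomial `X² + Y⁴` captures its primes*, Lemma 3.1: the weighted bound (3.13) and the dyadic step

Family `parity`, statement parity.S17. Source: J. Friedlander, H. Iwaniec, Ann. of Math. (2) 148
(1998), 945–1040 [FriedlanderIwaniecAnnals1998], §3, proof of Lemma 3.1 (arXiv p. 13):
"… we obtain (3.13) `∑_{d ≤ D} d |A_d(f) - M_d(f)| ≪ D^{1/2} x^{11/8 + ε} y^{-1}` … This implies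
`∑_{d ≤ D} |A_d(f) - M_d(f)| ≪ D^{1/2} x^{11/8+ε} y^{-1}` (dyadic decomposition in `d`)."

This file PROVES, for the oscillatory remainder `E_d = fiE x y d = A*_d(f) - M*_d(f)` of
`…Lemma31Smoothing`:

* `fiE_eq_sum_tsum`: `E_d = (4/d) ∑_{1 ≤ c ≤ C₁} ∑_{k ≥ 1} Re(ρ(k, c²; d) 𝓕F_c(k/d))`
  (`C₁ = ⌊⌊x⌋^{1/4}⌋`; from (3.11) = `fiSmoothSlice_eq_tsum`, `tsum_dual_eq`, and `c ↔ -c`);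
* `mul_abs_fiE_le`: `d |E_d| ≤ 4 |∑_{k ≤ K} ∑_{c ≤ C₁} ρ(k,c²;d) 𝓕F_c(k/d)| + 4 C₁ d · tail(d)`;
* **`sum_mul_abs_fiE_le`** ((3.13) before the choice of parameters): with the constant of Lemma 3.3,
  `∑_{d ≤ D} d |E_d| ≤ 4√x c (DKC₁²)^ε (D + √(DKC₁²)) √(2C₁) 4√K + 4 C₁ D² · 2 L¹ₙ (D/2π)ⁿ K^{1-n}`;
* **`dyadic_bound`**: if `∑_{d ≤ D'} d s_d ≤ A D'^{3/2}` for all `D'` then `∑_{d ≤ D} s_d ≤ 7A√D`.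

## References

* J. Friedlander, H. Iwaniec, Ann. of Math. (2) 148 (1998), 945–1040, §3, (3.11), (3.13).
  [cite: FriedlanderIwaniecAnnals1998, §3 (3.13)]

## Mathlib / tree search

Tree: `fiE`, `fiAstarSmooth`, `fiMstarSmooth`, `fiCRange` (`…Lemma31Smoothing`); `fiSmoothSlice_eq_tsum`,
`tsum_dual_eq`, `tsum_norm_dual_tail_le`, `summable_dual` (`…Lemma31Poisson`);
`sum_norm_oscillatory_le` (`…Lemma31Oscillatory`); `sum_Icc_neg_filter_ne_zero`,
`sum_Icc_int_eq_sum_Icc_nat` (`FriedlanderIwaniecPrimes`); `card_fiRoots_le` (`…WeylHarmonics`).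
Mathlib: `Summable.sum_add_tsum_nat_add`, `Nat.strong_induction_on`.
-/

noncomputable section

open Finset Real MeasureTheory Filter Complex
open scoped FourierTransform

namespace Literature.NumberTheory.Sieve.FriedlanderIwaniecPrimes

/-! ### The dual series of `E_d` -/

/-- The `k`-th term (`k ≥ 1`, indexed from `0`) of the dual series in the slice `c`:
`Re(ρ(k+1, c²; d) 𝓕F_c((k+1)/d))`. [cite: FriedlanderIwaniecAnnals1998, §3 (3.11)] -/
def fiDualTerm (x y : ℝ) (d : ℕ) (c : ℤ) (k : ℕ) : ℝ :=
  (fiWeyl (k + 1) (c.natAbs ^ 2) d * 𝓕 (fiProfileC x y ((c : ℝ) ^ 4)) (((k + 1 : ℕ) : ℝ) / d)).re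

/-- The complex dual terms are summable over `k ≥ 1`. [folklore] -/
theorem summable_dualC {x y : ℝ} (hy : 0 < y) (hyx : y ≤ x) {d : ℕ} (hd : 0 < d) (c : ℤ) :
    Summable fun k : ℕ => fiWeyl (k + 1) (c.natAbs ^ 2) d *
      𝓕 (fiProfileC x y ((c : ℝ) ^ 4)) (((k + 1 : ℕ) : ℝ) / d) := by
  have h := (summable_dual hy hyx hd c).comp_injective
    (show Function.Injective fun k : ℕ => ((k + 1 : ℕ) : ℤ) from fun a b h => by
      simpa using h)
  refine h.congr fun k => ?_
  simp only [Function.comp_apply, fiWeylInt_natCast, Int.cast_natCast]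

/-- The real dual terms are summable. [folklore] -/
theorem summable_fiDualTerm {x y : ℝ} (hy : 0 < y) (hyx : y ≤ x) {d : ℕ} (hd : 0 < d) (c : ℤ) :
    Summable (fiDualTerm x y d c) :=
  (Complex.reCLM.summable (summable_dualC hy hyx hd c))

/-- **The real part of a slice**: `Re A_d^{(c)}(f) = (ρ(c²;d) Re 𝓕F_c(0) + 2 ∑_k fiDualTerm)/d`.
[cite: FriedlanderIwaniecAnnals1998, §3 (3.11)] -/
theorem fiSmoothSlice_re_eq {x y : ℝ} (hx : 1 ≤ x) (hy : 0 < y) (hyx : y ≤ x) {d : ℕ} (hd : 0 < d)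
    (c : ℤ) :
    (fiSmoothSlice x y d c).re = ((#(fiRoots (c.natAbs ^ 2) d) : ℝ) *
      (𝓕 (fiProfileC x y ((c : ℝ) ^ 4)) 0).re + 2 * ∑' k, fiDualTerm x y d c k) / d := by
  rw [fiSmoothSlice_eq_tsum hx hy hd c, tsum_dual_eq hy hyx hd c]
  have h1 : (∑' k : ℕ, (((fiWeyl (k + 1) (c.natAbs ^ 2) d *
      𝓕 (fiProfileC x y ((c : ℝ) ^ 4)) (((k + 1 : ℕ) : ℝ) / d)).re : ℝ) : ℂ)) =
      ((∑' k, fiDualTerm x y d c k : ℝ) : ℂ) := by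
    rw [Complex.ofReal_tsum]; rfl
  rw [h1, show ((d : ℂ))⁻¹ = (((d : ℝ)⁻¹ : ℝ) : ℂ) by push_cast; rfl,
    show ((#(fiRoots (c.natAbs ^ 2) d) : ℂ)) = (((#(fiRoots (c.natAbs ^ 2) d) : ℝ)) : ℂ) by
      push_cast; rfl, Complex.re_ofReal_mul, Complex.add_re, Complex.re_ofReal_mul,
    show (2 : ℂ) = ((2 : ℝ) : ℂ) by norm_num, Complex.re_ofReal_mul, Complex.ofReal_re]
  field_simp

/-- **`E_d` as a dual series**: `E_d = (2/d) ∑_{c ∈ fiCRange} ∑_k fiDualTerm`.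
[cite: FriedlanderIwaniecAnnals1998, §3 (3.11)] -/
theorem fiE_eq {x y : ℝ} (hx : 1 ≤ x) (hy : 0 < y) (hyx : y ≤ x) {d : ℕ} (hd : 0 < d) :
    fiE x y d = 2 / d * ∑ c ∈ fiCRange ⌊x⌋₊, ∑' k, fiDualTerm x y d c k := by
  have hdr : (d : ℝ) ≠ 0 := by exact_mod_cast hd.ne'
  rw [fiE, fiAstarSmooth, fiMstarSmooth, sum_div, ← sum_sub_distrib, mul_sum]
  refine sum_congr rfl fun c _ => ?_
  rw [fiSmoothSlice_re_eq hx hy hyx hd c]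
  field_simp
  ring

/-- The dual terms are even in `c`. [folklore] -/
theorem fiDualTerm_neg (x y : ℝ) (d : ℕ) (c : ℤ) : fiDualTerm x y d (-c) = fiDualTerm x y d c := by
  unfold fiDualTerm
  rw [Int.natAbs_neg, Int.cast_neg, Even.neg_pow ⟨2, rfl⟩]

/-- **`E_d = (4/d) ∑_{1 ≤ c ≤ C₁} ∑_k fiDualTerm(c)`**, `C₁ = ⌊√⌊√⌊x⌋⌋⌋`.
[cite: FriedlanderIwaniecAnnals1998, §3 (3.11), "A_d(f) = (2/d) ∑_{b ≠ 0} …"] -/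
theorem fiE_eq_sum_tsum {x y : ℝ} (hx : 1 ≤ x) (hy : 0 < y) (hyx : y ≤ x) {d : ℕ} (hd : 0 < d) :
    fiE x y d = 4 / d * ∑ c ∈ Icc 1 (Nat.sqrt (Nat.sqrt ⌊x⌋₊)),
      ∑' k, fiDualTerm x y d (c : ℤ) k := by
  rw [fiE_eq hx hy hyx hd, fiCRange, sum_Icc_neg_filter_ne_zero (fun c => by
    simp only [fiDualTerm_neg]), sum_Icc_int_eq_sum_Icc_nat]
  ring

/-! ### Splitting the dual series at `K` -/

/-- **`d |E_d| ≤ 4 |∑_{k ≤ K} ∑_{c ≤ C₁} ρ(k, c²; d) 𝓕F_c(k/d)| + 4 C₁ d · tail(d)`** where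
`tail(d) = 2 (2√x n! Mₙ (2√x/y)ⁿ)(d/2π)ⁿ K^{1-n}` (`tsum_norm_dual_tail_le`, `ρ(c²; d) ≤ d`).
[cite: FriedlanderIwaniecAnnals1998, §3, display after (3.12)] -/
theorem mul_abs_fiE_le {x y : ℝ} (hx : 1 ≤ x) (hy : 0 < y) (hyx : y ≤ x) {d : ℕ} (hd : 0 < d)
    {n : ℕ} (hn : 2 ≤ n) {M : ℝ} (hM0 : 0 ≤ M)
    (hM : ∀ i ≤ n, ∀ s : ℝ, ‖iteratedFDeriv ℝ i Real.smoothTransition s‖ ≤ M) {K : ℕ} (hK : 1 ≤ K) :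
    (d : ℝ) * |fiE x y d| ≤
      4 * ‖∑ k ∈ Icc 1 K, ∑ c ∈ Icc 1 (Nat.sqrt (Nat.sqrt ⌊x⌋₊)),
        fiWeyl k (c ^ 2) d * 𝓕 (fiProfileC x y ((c : ℝ) ^ 4)) ((k : ℝ) / d)‖ +
      4 * (Nat.sqrt (Nat.sqrt ⌊x⌋₊)) * d * (2 * (2 * Real.sqrt x * (n.factorial * M *
        (2 * Real.sqrt x / y) ^ n)) * (d / (2 * π)) ^ n * ((K : ℝ) ^ (n - 1))⁻¹) := by
  have hdr : (0 : ℝ) < d := by exact_mod_cast hd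
  set C₁ := Nat.sqrt (Nat.sqrt ⌊x⌋₊) with hC₁
  set B : ℝ := 2 * (2 * Real.sqrt x * (n.factorial * M * (2 * Real.sqrt x / y) ^ n)) *
    (d / (2 * π)) ^ n * ((K : ℝ) ^ (n - 1))⁻¹ with hB
  have hB0 : 0 ≤ B := by positivity
  -- the complex dual terms in the slice `c : ℕ`
  set G : ℕ → ℕ → ℂ := fun c k => fiWeyl (k + 1) (c ^ 2) d *
    𝓕 (fiProfileC x y ((c : ℝ) ^ 4)) (((k + 1 : ℕ) : ℝ) / d) with hG
  have hGs : ∀ c : ℕ, Summable (G c) := by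
    intro c
    have := summable_dualC hy hyx hd (c : ℤ)
    simpa [hG, Int.natAbs_natCast] using this
  have hterm : ∀ c : ℕ, ∀ k, fiDualTerm x y d (c : ℤ) k = (G c k).re := by
    intro c k
    simp [fiDualTerm, hG, Int.natAbs_natCast]
  -- split each series at `K`
  have hsplit : ∀ c : ℕ, ∑' k, fiDualTerm x y d (c : ℤ) k =
      (∑ k ∈ range K, G c k).re + ∑' k, (G c (k + K)).re := by
    intro c
    have h1 : ∑' k, fiDualTerm x y d (c : ℤ) k = (∑' k, G c k).re := by
      rw [Complex.re_tsum (hGs c)]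
      exact tsum_congr (hterm c)
    rw [h1, ← (hGs c).sum_add_tsum_nat_add K, Complex.add_re, Complex.re_tsum]
    exact (summable_nat_add_iff K).mpr (hGs c)
  -- the tails
  have htail : ∀ c : ℕ, |∑' k, (G c (k + K)).re| ≤ d * B := by
    intro c
    have hs : Summable fun k => ‖G c (k + K)‖ := ((summable_nat_add_iff K).mpr (hGs c)).norm
    have hre : Summable fun k => (G c (k + K)).re :=
      Complex.reCLM.summable ((summable_nat_add_iff K).mpr (hGs c))
    have h1 : |∑' k, (G c (k + K)).re| ≤ ∑' k, ‖G c (k + K)‖ := by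
      refine (norm_tsum_le_tsum_norm hre.norm).trans ?_
      exact Summable.tsum_le_tsum (fun k => Complex.abs_re_le_norm _) hre.norm hs
    have h2 : ∑' k, ‖G c (k + K)‖ ≤ #(fiRoots (((c : ℤ)).natAbs ^ 2) d) * B := by
      have := tsum_norm_dual_tail_le hy hyx hd (c : ℤ) hn hM0 hM hK
      simp only [Int.natAbs_natCast, Int.cast_natCast] at this
      refine le_trans (le_of_eq (tsum_congr fun k => ?_)) this
      simp only [hG, Nat.add_right_comm k 1 K]
    have h3 : (#(fiRoots (((c : ℤ)).natAbs ^ 2) d) : ℝ) ≤ d := by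
      exact_mod_cast card_fiRoots_le _ _
    calc |∑' k, (G c (k + K)).re| ≤ ∑' k, ‖G c (k + K)‖ := h1
      _ ≤ #(fiRoots (((c : ℤ)).natAbs ^ 2) d) * B := h2
      _ ≤ d * B := mul_le_mul_of_nonneg_right h3 hB0
  -- the heads, reindexed by `k ∈ [1, K]`
  have hhead : ∑ c ∈ Icc 1 C₁, (∑ k ∈ range K, G c k).re =
      (∑ k ∈ Icc 1 K, ∑ c ∈ Icc 1 C₁,
        fiWeyl k (c ^ 2) d * 𝓕 (fiProfileC x y ((c : ℝ) ^ 4)) ((k : ℝ) / d)).re := by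
    rw [← Complex.re_sum, sum_comm]
    congr 1
    refine sum_nbij' (fun i => i + 1) (fun k => k - 1) ?_ ?_ ?_ ?_ ?_
    · intro i hi; rw [Finset.mem_range] at hi; rw [Finset.mem_Icc]; omega
    · intro k hk; rw [Finset.mem_Icc] at hk; rw [Finset.mem_range]; omega
    · intro i _; omega
    · intro k hk; rw [Finset.mem_Icc] at hk; omega
    · intro i _; rfl
  -- assemble
  rw [fiE_eq_sum_tsum hx hy hyx hd, ← hC₁, abs_mul, abs_div, abs_of_pos hdr,
    abs_of_pos (by norm_num : (0 : ℝ) < 4)]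
  rw [show (d : ℝ) * (4 / d * |∑ c ∈ Icc 1 C₁, ∑' k, fiDualTerm x y d (c : ℤ) k|) =
    4 * |∑ c ∈ Icc 1 C₁, ∑' k, fiDualTerm x y d (c : ℤ) k| by field_simp]
  simp_rw [hsplit]
  rw [sum_add_distrib, hhead]
  have hT : |∑ c ∈ Icc 1 C₁, ∑' k, (G c (k + K)).re| ≤ C₁ * (d * B) := by
    refine (abs_sum_le_sum_abs _ _).trans ?_
    calc ∑ c ∈ Icc 1 C₁, |∑' k, (G c (k + K)).re| ≤ ∑ c ∈ Icc 1 C₁, (d : ℝ) * B :=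
          sum_le_sum fun c _ => htail c
      _ = C₁ * (d * B) := by rw [sum_const, Nat.card_Icc, nsmul_eq_mul]; simp
  calc 4 * |(∑ k ∈ Icc 1 K, ∑ c ∈ Icc 1 C₁,
        fiWeyl k (c ^ 2) d * 𝓕 (fiProfileC x y ((c : ℝ) ^ 4)) ((k : ℝ) / d)).re +
        ∑ c ∈ Icc 1 C₁, ∑' k, (G c (k + K)).re|
      ≤ 4 * (‖∑ k ∈ Icc 1 K, ∑ c ∈ Icc 1 C₁,
        fiWeyl k (c ^ 2) d * 𝓕 (fiProfileC x y ((c : ℝ) ^ 4)) ((k : ℝ) / d)‖ + C₁ * (d * B)) := by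
        refine mul_le_mul_of_nonneg_left ((abs_add_le _ _).trans (add_le_add
          (Complex.abs_re_le_norm _) hT)) (by norm_num)
    _ = _ := by rw [hB]; ring

/-- **The whole dual series as a tail** (used when `K₀ = D'x^{1/2+η}/y < 1`, i.e. no head):
`∑_{k ≥ 1} |ρ(k, c²; d) 𝓕F_c(k/d)| ≤ ρ(c²; d) · L¹ₙ (d/2π)ⁿ · 2` with `L¹ₙ ≤ 2√x n! Mₙ (2√x/y)ⁿ`.
[cite: FriedlanderIwaniecAnnals1998, §3, "Estimating the tail of the Fourier series (3.11) trivially"] -/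
theorem tsum_norm_dual_le {x y : ℝ} (hy : 0 < y) (hyx : y ≤ x) {d : ℕ} (hd : 0 < d) (c : ℤ)
    {n : ℕ} (hn : 2 ≤ n) {M : ℝ} (hM0 : 0 ≤ M)
    (hM : ∀ i ≤ n, ∀ s : ℝ, ‖iteratedFDeriv ℝ i Real.smoothTransition s‖ ≤ M) :
    ∑' k : ℕ, ‖fiWeyl (k + 1) (c.natAbs ^ 2) d * 𝓕 (fiProfileC x y ((c : ℝ) ^ 4)) (((k + 1 : ℕ) : ℝ) / d)‖
      ≤ #(fiRoots (c.natAbs ^ 2) d) * ((2 * Real.sqrt x * (n.factorial * M * (2 * Real.sqrt x / y) ^ n)) *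
        (d / (2 * π)) ^ n * 2) := by
  have hdr : (0 : ℝ) < d := by exact_mod_cast hd
  set ℓ := c.natAbs ^ 2 with hℓ
  set F := fiProfileC x y ((c : ℝ) ^ 4) with hF
  have hFd : ContDiff ℝ ((⊤ : ℕ∞) : WithTop ℕ∞) F := contDiff_fiProfileC _ _ _
  have hFc : HasCompactSupport F := hasCompactSupport_fiProfileC hy (by positivity) (hy.le.trans hyx)
  set L : ℝ := ∫ t, ‖iteratedDeriv n F t‖ with hL
  have hL0 : 0 ≤ L := integral_nonneg fun _ => norm_nonneg _
  have hLle : L ≤ 2 * Real.sqrt x * (n.factorial * M * (2 * Real.sqrt x / y) ^ n) :=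
    integral_norm_iteratedDeriv_fiProfileC_le hy hyx (by positivity) hM0 hM
  have hρ : (0 : ℝ) ≤ #(fiRoots ℓ d) := Nat.cast_nonneg _
  -- termwise
  have hk : ∀ m : ℕ, ‖fiWeyl (m + 1) ℓ d * 𝓕 F (((m + 1 : ℕ) : ℝ) / d)‖ ≤
      #(fiRoots ℓ d) * (L * (d / (2 * π)) ^ n) * (((m + 1 : ℕ) : ℝ) ^ 2)⁻¹ := by
    intro m
    rw [norm_mul]
    have h1 := norm_fiWeyl_le (m + 1) ℓ d
    have h2 := norm_fourier_div_le hFd hFc n hdr (k := ((m + 1 : ℕ) : ℝ)) (by positivity)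
    rw [abs_of_nonneg (by positivity)] at h2
    have h3 : (((((m + 1 : ℕ) : ℝ)) ^ n)⁻¹) ≤ ((((m + 1 : ℕ) : ℝ)) ^ 2)⁻¹ := by
      rw [inv_le_inv₀ (by positivity) (by positivity)]
      exact pow_le_pow_right₀ (by norm_cast; omega) hn
    calc ‖fiWeyl (m + 1) ℓ d‖ * ‖𝓕 F (((m + 1 : ℕ) : ℝ) / d)‖
        ≤ #(fiRoots ℓ d) * (L * (d / (2 * π)) ^ n * ((((m + 1 : ℕ) : ℝ)) ^ n)⁻¹) :=
          mul_le_mul h1 h2 (norm_nonneg _) hρ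
      _ ≤ #(fiRoots ℓ d) * (L * (d / (2 * π)) ^ n * ((((m + 1 : ℕ) : ℝ)) ^ 2)⁻¹) := by gcongr
      _ = _ := by ring
  refine tsum_le_of_sum_range_le (fun _ => norm_nonneg _) fun m => ?_
  calc ∑ i ∈ range m, ‖fiWeyl (i + 1) ℓ d * 𝓕 F (((i + 1 : ℕ) : ℝ) / d)‖
      ≤ ∑ i ∈ range m, #(fiRoots ℓ d) * (L * (d / (2 * π)) ^ n) * (((i + 1 : ℕ) : ℝ) ^ 2)⁻¹ :=
        sum_le_sum fun i _ => hk i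
    _ = #(fiRoots ℓ d) * (L * (d / (2 * π)) ^ n) * ∑ k ∈ Icc 1 m, ((k : ℝ) ^ 2)⁻¹ := by
        rw [mul_sum]
        refine sum_nbij' (fun i => i + 1) (fun k => k - 1) ?_ ?_ ?_ ?_ ?_
        · intro i hi; rw [Finset.mem_range] at hi; rw [Finset.mem_Icc]; omega
        · intro k hk; rw [Finset.mem_Icc] at hk; rw [Finset.mem_range]; omega
        · intro i _; omega
        · intro k hk; rw [Finset.mem_Icc] at hk; omega
        · intro i _; rfl
    _ ≤ #(fiRoots ℓ d) * (L * (d / (2 * π)) ^ n) * 2 :=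
        mul_le_mul_of_nonneg_left (sum_Icc_inv_sq_le_two m) (by positivity)
    _ ≤ #(fiRoots ℓ d) * ((2 * Real.sqrt x * (n.factorial * M * (2 * Real.sqrt x / y) ^ n)) *
        (d / (2 * π)) ^ n * 2) := by
        rw [mul_assoc]
        refine mul_le_mul_of_nonneg_left ?_ hρ
        gcongr

/-- **`d |E_d| ≤ 8 C₁ d · L¹ₙ (d/2π)ⁿ`** (no head: every `k ≥ 1` in the tail).
[cite: FriedlanderIwaniecAnnals1998, §3, tail of (3.11)] -/
theorem mul_abs_fiE_le_tail {x y : ℝ} (hx : 1 ≤ x) (hy : 0 < y) (hyx : y ≤ x) {d : ℕ} (hd : 0 < d)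
    {n : ℕ} (hn : 2 ≤ n) {M : ℝ} (hM0 : 0 ≤ M)
    (hM : ∀ i ≤ n, ∀ s : ℝ, ‖iteratedFDeriv ℝ i Real.smoothTransition s‖ ≤ M) :
    (d : ℝ) * |fiE x y d| ≤ 8 * (Nat.sqrt (Nat.sqrt ⌊x⌋₊)) * d *
      ((2 * Real.sqrt x * (n.factorial * M * (2 * Real.sqrt x / y) ^ n)) * (d / (2 * π)) ^ n) := by
  have hdr : (0 : ℝ) < d := by exact_mod_cast hd
  set C₁ := Nat.sqrt (Nat.sqrt ⌊x⌋₊) with hC₁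
  set B : ℝ := (2 * Real.sqrt x * (n.factorial * M * (2 * Real.sqrt x / y) ^ n)) *
    (d / (2 * π)) ^ n with hB
  have hB0 : 0 ≤ B := by positivity
  have hc : ∀ c : ℕ, |∑' k, fiDualTerm x y d (c : ℤ) k| ≤ d * (B * 2) := by
    intro c
    have hs := summable_dualC hy hyx hd (c : ℤ)
    have hre : Summable (fiDualTerm x y d (c : ℤ)) := summable_fiDualTerm hy hyx hd _
    calc |∑' k, fiDualTerm x y d (c : ℤ) k| ≤ ∑' k, ‖fiWeyl (k + 1) (((c : ℤ)).natAbs ^ 2) d *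
          𝓕 (fiProfileC x y ((((c : ℤ)) : ℝ) ^ 4)) (((k + 1 : ℕ) : ℝ) / d)‖ := by
          refine (norm_tsum_le_tsum_norm hre.norm).trans ?_
          exact Summable.tsum_le_tsum (fun k => Complex.abs_re_le_norm _) hre.norm hs.norm
      _ ≤ #(fiRoots (((c : ℤ)).natAbs ^ 2) d) * (B * 2) := by
          have := tsum_norm_dual_le hy hyx hd (c : ℤ) hn hM0 hM
          rw [hB]; simpa [mul_assoc] using this
      _ ≤ d * (B * 2) :=
          mul_le_mul_of_nonneg_right (by exact_mod_cast card_fiRoots_le _ _) (by positivity)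
  rw [fiE_eq_sum_tsum hx hy hyx hd, ← hC₁, abs_mul, abs_div, abs_of_pos hdr,
    abs_of_pos (by norm_num : (0 : ℝ) < 4)]
  rw [show (d : ℝ) * (4 / d * |∑ c ∈ Icc 1 C₁, ∑' k, fiDualTerm x y d (c : ℤ) k|) =
    4 * |∑ c ∈ Icc 1 C₁, ∑' k, fiDualTerm x y d (c : ℤ) k| by field_simp]
  calc 4 * |∑ c ∈ Icc 1 C₁, ∑' k, fiDualTerm x y d (c : ℤ) k|
      ≤ 4 * ∑ c ∈ Icc 1 C₁, |∑' k, fiDualTerm x y d (c : ℤ) k| :=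
        mul_le_mul_of_nonneg_left (abs_sum_le_sum_abs _ _) (by norm_num)
    _ ≤ 4 * ∑ c ∈ Icc 1 C₁, (d : ℝ) * (B * 2) :=
        mul_le_mul_of_nonneg_left (sum_le_sum fun c _ => hc c) (by norm_num)
    _ = 8 * C₁ * d * B := by rw [sum_const, Nat.card_Icc, nsmul_eq_mul]; simp; ring

/-! ### The dyadic step -/

/-- **Dyadic decomposition in `d`**: if `s ≥ 0` and `∑_{d ≤ D'} d s_d ≤ A D'^{3/2}` for all
`1 ≤ D' ≤ D`, then `∑_{d ≤ D} s_d ≤ 7A√D` (split at `D/2` and induct: `7/√2 + 2 ≤ 7`).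
[cite: FriedlanderIwaniecAnnals1998, §3, "This implies … (3.13) ⇒ ∑_{d ≤ D} |A_d(f) - M_d(f)| ≪ D^{1/2} …"] -/
theorem dyadic_bound {s : ℕ → ℝ} (hs : ∀ d, 0 ≤ s d) {A : ℝ} (hA : 0 ≤ A) (D : ℕ)
    (h : ∀ D' : ℕ, 1 ≤ D' → D' ≤ D → ∑ d ∈ Icc 1 D', (d : ℝ) * s d ≤ A * (D' : ℝ) ^ (3 / 2 : ℝ)) :
    ∑ d ∈ Icc 1 D, s d ≤ 7 * A * Real.sqrt D := by
  induction D using Nat.strong_induction_on with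
  | _ D ih =>
    rcases Nat.eq_zero_or_pos D with rfl | hD
    · simp
    set H := D / 2 with hH
    have hHD : H < D := Nat.div_lt_self hD one_lt_two
    have hH2 : D ≤ 2 * (H + 1) := by omega
    have hDr : (0 : ℝ) < D := by exact_mod_cast hD
    -- the lower half by induction
    have hlow : ∑ d ∈ Icc 1 H, s d ≤ 7 * A * Real.sqrt H :=
      ih H hHD fun D' h1 h2 => h D' h1 (h2.trans hHD.le)
    -- the upper block
    have hup : ∑ d ∈ Ioc H D, s d ≤ 2 * A * Real.sqrt D := by
      have h1 : ∀ d ∈ Ioc H D, s d ≤ (2 / D) * ((d : ℝ) * s d) := by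
        intro d hd
        rw [Finset.mem_Ioc] at hd
        have hd2 : (D : ℝ) ≤ 2 * d := by exact_mod_cast (by omega : D ≤ 2 * d)
        rw [← mul_assoc, div_mul_eq_mul_div]
        refine le_mul_of_one_le_left (hs d) ?_
        rw [one_le_div hDr]
        exact hd2
      have h2 : ∑ d ∈ Ioc H D, (d : ℝ) * s d ≤ A * (D : ℝ) ^ (3 / 2 : ℝ) := by
        calc ∑ d ∈ Ioc H D, (d : ℝ) * s d ≤ ∑ d ∈ Icc 1 D, (d : ℝ) * s d :=
              sum_le_sum_of_subset_of_nonneg (fun d hd => by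
                rw [Finset.mem_Ioc] at hd; rw [Finset.mem_Icc]; omega)
                fun d _ _ => mul_nonneg (Nat.cast_nonneg _) (hs d)
          _ ≤ A * (D : ℝ) ^ (3 / 2 : ℝ) := h D hD le_rfl
      have h32 : (D : ℝ) ^ (3 / 2 : ℝ) = D * Real.sqrt D := by
        rw [show (3 / 2 : ℝ) = 1 + 1 / 2 by norm_num, Real.rpow_add hDr, Real.rpow_one,
          Real.sqrt_eq_rpow]
      calc ∑ d ∈ Ioc H D, s d ≤ ∑ d ∈ Ioc H D, (2 / D) * ((d : ℝ) * s d) := sum_le_sum h1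
        _ = (2 / D) * ∑ d ∈ Ioc H D, (d : ℝ) * s d := (mul_sum _ _ _).symm
        _ ≤ (2 / D) * (A * (D : ℝ) ^ (3 / 2 : ℝ)) :=
            mul_le_mul_of_nonneg_left h2 (by positivity)
        _ = 2 * A * Real.sqrt D := by rw [h32]; field_simp
    -- combine: `7√H + 2√D ≤ 7√D` since `H ≤ D/2` and `7/√2 + 2 ≤ 7`
    have hsplit : ∑ d ∈ Icc 1 D, s d = ∑ d ∈ Icc 1 H, s d + ∑ d ∈ Ioc H D, s d := by
      rw [← sum_union]
      · congr 1
        ext d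
        simp only [Finset.mem_union, Finset.mem_Icc, Finset.mem_Ioc]
        omega
      · rw [Finset.disjoint_left]
        intro d h1 h2
        rw [Finset.mem_Icc] at h1
        rw [Finset.mem_Ioc] at h2
        omega
    rw [hsplit]
    have hsqrt : Real.sqrt H ≤ Real.sqrt D / Real.sqrt 2 := by
      rw [le_div_iff₀ (Real.sqrt_pos.mpr two_pos), ← Real.sqrt_mul (Nat.cast_nonneg _)]
      refine Real.sqrt_le_sqrt ?_
      exact_mod_cast (by omega : H * 2 ≤ D)
    have hs2 : (1.4 : ℝ) ≤ Real.sqrt 2 := by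
      rw [Real.le_sqrt (by norm_num) (by norm_num)]; norm_num
    have hAD : 0 ≤ A * Real.sqrt D := by positivity
    calc ∑ d ∈ Icc 1 H, s d + ∑ d ∈ Ioc H D, s d
        ≤ 7 * A * (Real.sqrt D / Real.sqrt 2) + 2 * A * Real.sqrt D := by
          refine add_le_add (hlow.trans ?_) hup
          exact mul_le_mul_of_nonneg_left hsqrt (by positivity)
      _ = (7 / Real.sqrt 2 + 2) * (A * Real.sqrt D) := by ring
      _ ≤ 7 * (A * Real.sqrt D) := by
          refine mul_le_mul_of_nonneg_right ?_ hAD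
          rw [div_add' _ _ _ (by positivity), div_le_iff₀ (by positivity)]
          linarith
      _ = 7 * A * Real.sqrt D := by ring

/-! ### The choice `K ≍ D'x^{1/2+η}/y` and the bound `∑_{d ≤ D'} d|E_d| ≤ A D'^{3/2}` -/

/-- `C₁ = ⌊√⌊√⌊x⌋⌋⌋ ≤ x^{1/4}`. [folklore] -/
theorem natSqrtSqrt_le_rpow {x : ℝ} (hx : 0 ≤ x) : (Nat.sqrt (Nat.sqrt ⌊x⌋₊) : ℝ) ≤ x ^ (1 / 4 : ℝ) := by
  set C₁ := Nat.sqrt (Nat.sqrt ⌊x⌋₊) with hC₁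
  have h4 : ((C₁ ^ 4 : ℕ) : ℝ) ≤ x := by
    have : C₁ ^ 4 ≤ ⌊x⌋₊ := (le_sqrt_sqrt_iff C₁ ⌊x⌋₊).mp le_rfl
    exact le_trans (by exact_mod_cast this) (Nat.floor_le hx)
  calc (C₁ : ℝ) = (((C₁ : ℝ) ^ 4)) ^ (1 / 4 : ℝ) := by
        rw [← Real.rpow_natCast, ← Real.rpow_mul (Nat.cast_nonneg _)]; norm_num
    _ ≤ x ^ (1 / 4 : ℝ) := Real.rpow_le_rpow (by positivity) (by exact_mod_cast h4) (by norm_num)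

/-- `(a)ⁿ ≤ x^{-4}` for `0 ≤ a ≤ x^{-η}`, `x ≥ 1`, `ηn ≥ 4`. [folklore] -/
theorem pow_le_rpow_neg_four {x η a : ℝ} (hx : 1 ≤ x) (ha0 : 0 ≤ a) (ha : a ≤ x ^ (-η)) {n : ℕ}
    (hηn : 4 ≤ η * n) : a ^ n ≤ x ^ (-(4 : ℝ)) := by
  have hx0 : 0 < x := by linarith
  calc a ^ n ≤ (x ^ (-η)) ^ n := pow_le_pow_left₀ ha0 ha n
    _ = x ^ (-(η * n)) := by rw [← Real.rpow_natCast, ← Real.rpow_mul hx0.le]; ring_nf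
    _ ≤ x ^ (-(4 : ℝ)) := Real.rpow_le_rpow_of_exponent_le hx (by linarith)

/-- `∑_{d ≤ D'} d (d/2π)ⁿ w ≤ D'² (D'/2π)ⁿ w` for `w ≥ 0`. [folklore] -/
theorem sum_mul_pow_div_le {w : ℝ} (hw : 0 ≤ w) (n D' : ℕ) :
    ∑ d ∈ Icc 1 D', (d : ℝ) * ((d : ℝ) / (2 * π)) ^ n * w ≤
      (D' : ℝ) * ((D' : ℝ) * ((D' : ℝ) / (2 * π)) ^ n * w) := by
  calc ∑ d ∈ Icc 1 D', (d : ℝ) * ((d : ℝ) / (2 * π)) ^ n * w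
      ≤ ∑ d ∈ Icc 1 D', (D' : ℝ) * ((D' : ℝ) / (2 * π)) ^ n * w := by
        refine sum_le_sum fun d hd => ?_
        rw [Finset.mem_Icc] at hd
        have hdD : (d : ℝ) ≤ D' := by exact_mod_cast hd.2
        gcongr
    _ = (D' : ℝ) * ((D' : ℝ) * ((D' : ℝ) / (2 * π)) ^ n * w) := by
        rw [sum_const, Nat.card_Icc, nsmul_eq_mul]; simp

/-- **The regime `D'x^{1/2+η} < y` (no head)**: `∑_{d ≤ D'} d|E_d| ≤ 32 n! M D'^{3/2}`.
[cite: FriedlanderIwaniecAnnals1998, §3, tail of (3.11)] -/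
theorem sum_mul_abs_fiE_le_of_small {x y η : ℝ} (hx : 1 ≤ x) (hy : 0 < y)
    (hyx : y ≤ x) {n : ℕ} (hn : 2 ≤ n) (hηn : 4 ≤ η * n) {M : ℝ} (hM0 : 0 ≤ M)
    (hM : ∀ i ≤ n, ∀ s : ℝ, ‖iteratedFDeriv ℝ i Real.smoothTransition s‖ ≤ M) {D' : ℕ}
    (hD'x : (D' : ℝ) ≤ x) (hsmall : (D' : ℝ) * x ^ (1 / 2 + η) ≤ y) :
    ∑ d ∈ Icc 1 D', (d : ℝ) * |fiE x y d| ≤ 32 * n.factorial * M * (D' : ℝ) ^ (3 / 2 : ℝ) := by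
  have hx0 : 0 < x := by linarith
  have hC₁x := natSqrtSqrt_le_rpow hx0.le
  set C₁ := Nat.sqrt (Nat.sqrt ⌊x⌋₊) with hC₁
  set a : ℝ := 2 * Real.sqrt x / y * ((D' : ℝ) / (2 * π)) with ha
  have ha0 : 0 ≤ a := by positivity
  -- `a = √x D'/(π y) ≤ √x D'/y ≤ x^{-η}`
  have ha1 : a ≤ x ^ (-η) := by
    have h1 : a ≤ Real.sqrt x * D' / y := by
      rw [ha, show 2 * Real.sqrt x / y * ((D' : ℝ) / (2 * π)) = Real.sqrt x * D' / y * (1 / π) by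
        field_simp]
      refine mul_le_of_le_one_right (by positivity) ?_
      rw [div_le_one Real.pi_pos]
      linarith [Real.pi_gt_three]
    refine h1.trans ?_
    rw [div_le_iff₀ hy]
    calc Real.sqrt x * D' = x ^ (-η) * ((D' : ℝ) * x ^ (1 / 2 + η)) := by
          rw [Real.sqrt_eq_rpow, mul_comm (D' : ℝ), ← mul_assoc, ← Real.rpow_add hx0]
          ring_nf
      _ ≤ x ^ (-η) * y := mul_le_mul_of_nonneg_left hsmall (by positivity)
  have han : a ^ n ≤ x ^ (-(4 : ℝ)) := pow_le_rpow_neg_four hx ha0 ha1 hηn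
  -- termwise bound and summation
  set Lb : ℝ := 2 * Real.sqrt x * (n.factorial * M * (2 * Real.sqrt x / y) ^ n) with hLb
  calc ∑ d ∈ Icc 1 D', (d : ℝ) * |fiE x y d|
      ≤ ∑ d ∈ Icc 1 D', (d : ℝ) * ((d : ℝ) / (2 * π)) ^ n * (8 * C₁ * Lb) := by
        refine sum_le_sum fun d hd => ?_
        rw [Finset.mem_Icc] at hd
        have := mul_abs_fiE_le_tail hx hy hyx (d := d) (by omega) hn hM0 hM
        refine this.trans (le_of_eq ?_)
        rw [hLb]; ring
    _ ≤ (D' : ℝ) * ((D' : ℝ) * ((D' : ℝ) / (2 * π)) ^ n * (8 * C₁ * Lb)) :=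
        sum_mul_pow_div_le (by positivity) n D'
    _ = 16 * n.factorial * M * (C₁ * Real.sqrt x * a ^ n * (D' : ℝ) ^ 2) := by
        rw [hLb, ha, mul_pow, sq]; ring
    _ ≤ 16 * n.factorial * M * (x ^ (1 / 4 : ℝ) * x ^ (1 / 2 : ℝ) * x ^ (-(4 : ℝ)) *
          ((D' : ℝ) ^ (3 / 2 : ℝ) * x ^ (1 / 2 : ℝ))) := by
        have hD2 : (D' : ℝ) ^ 2 ≤ (D' : ℝ) ^ (3 / 2 : ℝ) * x ^ (1 / 2 : ℝ) := by
          rcases Nat.eq_zero_or_pos D' with rfl | hD'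
          · simp
          have hD'0 : (0 : ℝ) < D' := by exact_mod_cast hD'
          calc (D' : ℝ) ^ 2 = (D' : ℝ) ^ (3 / 2 : ℝ) * (D' : ℝ) ^ (1 / 2 : ℝ) := by
                rw [← Real.rpow_add hD'0, ← Real.rpow_natCast]; norm_num
            _ ≤ (D' : ℝ) ^ (3 / 2 : ℝ) * x ^ (1 / 2 : ℝ) := by
                gcongr
        rw [Real.sqrt_eq_rpow]
        gcongr
    _ = 16 * n.factorial * M * (D' : ℝ) ^ (3 / 2 : ℝ) * x ^ (-(11 / 4) : ℝ) := by
        have : x ^ (1 / 4 : ℝ) * x ^ (1 / 2 : ℝ) * x ^ (-(4 : ℝ)) * x ^ (1 / 2 : ℝ) =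
            x ^ (-(11 / 4) : ℝ) := by
          rw [← Real.rpow_add hx0, ← Real.rpow_add hx0, ← Real.rpow_add hx0]; norm_num
        rw [← this]; ring
    _ ≤ 16 * n.factorial * M * (D' : ℝ) ^ (3 / 2 : ℝ) * 1 := by
        gcongr
        exact Real.rpow_le_one_of_one_le_of_nonpos hx (by norm_num)
    _ ≤ 32 * n.factorial * M * (D' : ℝ) ^ (3 / 2 : ℝ) := by
        have : 0 ≤ (n.factorial : ℝ) * M * (D' : ℝ) ^ (3 / 2 : ℝ) := by positivity
        nlinarith

/-- `√(x^{1/2+η}/y) ≤ x^{3/4+η}/y` for `1 ≤ x`, `0 < y ≤ x`, `η ≥ 0`. [folklore] -/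
theorem sqrt_rpow_div_le {x y η : ℝ} (hx : 1 ≤ x) (hy0 : 0 < y) (hyx : y ≤ x) (hη : 0 ≤ η) :
    Real.sqrt (x ^ (1 / 2 + η) / y) ≤ x ^ (3 / 4 + η) / y := by
  have hx0 : 0 < x := by linarith
  rw [Real.sqrt_le_left (by positivity), div_pow, div_le_div_iff₀ hy0 (by positivity),
    ← Real.rpow_natCast (x ^ (3 / 4 + η)) 2, ← Real.rpow_mul hx0.le]
  calc x ^ (1 / 2 + η) * y ^ (2 : ℕ) = x ^ (1 / 2 + η) * y * y := by ring
    _ ≤ x ^ (1 / 2 + η) * x ^ (1 + η) * y := by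
        refine mul_le_mul_of_nonneg_right (mul_le_mul_of_nonneg_left ?_ (by positivity)) hy0.le
        calc y ≤ x := hyx
          _ = x ^ (1 : ℝ) := (Real.rpow_one x).symm
          _ ≤ x ^ (1 + η) := Real.rpow_le_rpow_of_exponent_le hx (by linarith)
    _ = x ^ ((3 / 4 + η) * ((2 : ℕ) : ℝ)) * y := by
        rw [← Real.rpow_add hx0]; congr 2; push_cast; ring

/-- The head factor: `(D' + √(D'KC₁²))·4√K ≤ 14 D'^{3/2} x^{3/4+η}/y` when `K ≤ 2D'x^{1/2+η}/y`,
`C₁ ≤ x^{1/4}`, `y ≤ x`. [cite: FriedlanderIwaniecAnnals1998, §3, "(3.13) … D^{1/2} x^{11/8+ε} y^{-1}"] -/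
theorem head_factor_le {x y η t K C : ℝ} (hx : 1 ≤ x) (hy0 : 0 < y) (hyx : y ≤ x) (hη : 0 ≤ η)
    (ht0 : 0 < t) (hK0 : 0 ≤ K) (hK2 : K ≤ 2 * (t * x ^ (1 / 2 + η) / y)) (hC0 : 0 ≤ C)
    (hCx : C ≤ x ^ (1 / 4 : ℝ)) :
    (t + Real.sqrt (t * K * C ^ 2)) * (4 * Real.sqrt K) ≤
      14 * (t ^ (3 / 2 : ℝ) * (x ^ (3 / 4 + η) / y)) := by
  have hx0 : 0 < x := by linarith
  have ht' := sqrt_rpow_div_le hx hy0 hyx hη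
  have hsqrtK : Real.sqrt K ≤ Real.sqrt 2 * Real.sqrt t * (x ^ (3 / 4 + η) / y) := by
    calc Real.sqrt K ≤ Real.sqrt (2 * (t * x ^ (1 / 2 + η) / y)) := Real.sqrt_le_sqrt hK2
      _ = Real.sqrt 2 * Real.sqrt t * Real.sqrt (x ^ (1 / 2 + η) / y) := by
          rw [show 2 * (t * x ^ (1 / 2 + η) / y) = 2 * (t * (x ^ (1 / 2 + η) / y)) by ring,
            Real.sqrt_mul (by norm_num), Real.sqrt_mul ht0.le, mul_assoc]
      _ ≤ Real.sqrt 2 * Real.sqrt t * (x ^ (3 / 4 + η) / y) := by gcongr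
  have ht32 : t * Real.sqrt t = t ^ (3 / 2 : ℝ) := by
    rw [Real.sqrt_eq_rpow, show (3 / 2 : ℝ) = 1 + 1 / 2 by norm_num, Real.rpow_add ht0,
      Real.rpow_one]
  have h1 : t * (4 * Real.sqrt K) ≤ 4 * Real.sqrt 2 * (t ^ (3 / 2 : ℝ) * (x ^ (3 / 4 + η) / y)) := by
    calc t * (4 * Real.sqrt K) ≤ t * (4 * (Real.sqrt 2 * Real.sqrt t * (x ^ (3 / 4 + η) / y))) := by
          gcongr
      _ = 4 * Real.sqrt 2 * ((t * Real.sqrt t) * (x ^ (3 / 4 + η) / y)) := by ring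
      _ = _ := by rw [ht32]
  have hsqrtQ : Real.sqrt (t * K * C ^ 2) = Real.sqrt t * Real.sqrt K * C := by
    rw [Real.sqrt_mul (by positivity), Real.sqrt_mul ht0.le, Real.sqrt_sq hC0]
  have h2 : Real.sqrt (t * K * C ^ 2) * (4 * Real.sqrt K) ≤
      8 * (t ^ (3 / 2 : ℝ) * (x ^ (3 / 4 + η) / y)) := by
    rw [hsqrtQ, show Real.sqrt t * Real.sqrt K * C * (4 * Real.sqrt K) =
      4 * Real.sqrt t * (Real.sqrt K * Real.sqrt K) * C by ring, Real.mul_self_sqrt hK0]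
    calc 4 * Real.sqrt t * K * C ≤ 4 * Real.sqrt t * (2 * (t * x ^ (1 / 2 + η) / y)) *
          x ^ (1 / 4 : ℝ) := by gcongr
      _ = 8 * ((t * Real.sqrt t) * (x ^ (1 / 2 + η) * x ^ (1 / 4 : ℝ) / y)) := by ring
      _ = 8 * (t ^ (3 / 2 : ℝ) * (x ^ (3 / 4 + η) / y)) := by
          rw [ht32, ← Real.rpow_add hx0]; ring_nf
  rw [add_mul]
  have hs2 : Real.sqrt 2 ≤ 1.5 := by rw [Real.sqrt_le_left (by norm_num)]; norm_num
  have h0 : 0 ≤ t ^ (3 / 2 : ℝ) * (x ^ (3 / 4 + η) / y) := by positivity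
  nlinarith

/-- `Q^{ε₃} ≤ 2 x^{5ε₃/2}` for `0 ≤ Q ≤ 2x^{5/2}`, `0 < ε₃ ≤ 1`. [folklore] -/
theorem rpow_eps_le {x Q ε₃ : ℝ} (hx0 : 0 < x) (hQ0 : 0 ≤ Q) (hQ : Q ≤ 2 * x ^ (5 / 2 : ℝ))
    (hε₃ : 0 < ε₃) (hε₃1 : ε₃ ≤ 1) : Q ^ ε₃ ≤ 2 * x ^ (5 / 2 * ε₃) := by
  calc Q ^ ε₃ ≤ (2 * x ^ (5 / 2 : ℝ)) ^ ε₃ := Real.rpow_le_rpow hQ0 hQ hε₃.le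
    _ = (2 : ℝ) ^ ε₃ * x ^ (5 / 2 * ε₃) := by
        rw [Real.mul_rpow (by norm_num) (by positivity), ← Real.rpow_mul hx0.le]
    _ ≤ 2 * x ^ (5 / 2 * ε₃) := by
        gcongr
        calc (2 : ℝ) ^ ε₃ ≤ (2 : ℝ) ^ (1 : ℝ) := Real.rpow_le_rpow_of_exponent_le (by norm_num) hε₃1
          _ = 2 := Real.rpow_one 2

/-- The tail factor: `16 n!M · C₁√x D'² K (a/K)ⁿ ≤ 32 n!M D'^{3/2}` when `C₁ ≤ x^{1/4}`, `D' ≤ x`,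
`K ≤ 2x`, `(a/K)ⁿ ≤ x^{-4}`. [folklore] -/
theorem tail_factor_le {x t K C r : ℝ} (hx : 1 ≤ x) (ht0 : 0 < t) (htx : t ≤ x) (hK0 : 0 ≤ K)
    (hKx : K ≤ 2 * x) (hCx : C ≤ x ^ (1 / 4 : ℝ)) (hr0 : 0 ≤ r)
    (hr : r ≤ x ^ (-(4 : ℝ))) {F : ℝ} (hF : 0 ≤ F) :
    F * (C * Real.sqrt x * t ^ 2 * (K * r)) ≤ 2 * F * t ^ (3 / 2 : ℝ) := by
  have hx0 : 0 < x := by linarith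
  have ht2 : t ^ 2 ≤ t ^ (3 / 2 : ℝ) * x ^ (1 / 2 : ℝ) := by
    calc t ^ 2 = t ^ (3 / 2 : ℝ) * t ^ (1 / 2 : ℝ) := by
          rw [← Real.rpow_add ht0, ← Real.rpow_natCast]; norm_num
      _ ≤ t ^ (3 / 2 : ℝ) * x ^ (1 / 2 : ℝ) := by gcongr
  have hprod : x ^ (1 / 4 : ℝ) * x ^ (1 / 2 : ℝ) * x ^ (1 / 2 : ℝ) * x * x ^ (-(4 : ℝ)) ≤ 1 := by
    have : x ^ (1 / 4 : ℝ) * x ^ (1 / 2 : ℝ) * x ^ (1 / 2 : ℝ) * x * x ^ (-(4 : ℝ)) =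
        x ^ (-(7 / 4) : ℝ) := by
      nth_rewrite 4 [← Real.rpow_one x]
      rw [← Real.rpow_add hx0, ← Real.rpow_add hx0, ← Real.rpow_add hx0, ← Real.rpow_add hx0]
      norm_num
    rw [this]
    exact Real.rpow_le_one_of_one_le_of_nonpos hx (by norm_num)
  calc F * (C * Real.sqrt x * t ^ 2 * (K * r))
      ≤ F * (x ^ (1 / 4 : ℝ) * x ^ (1 / 2 : ℝ) * (t ^ (3 / 2 : ℝ) * x ^ (1 / 2 : ℝ)) *
          ((2 * x) * x ^ (-(4 : ℝ)))) := by
        rw [Real.sqrt_eq_rpow]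
        gcongr
    _ = 2 * F * t ^ (3 / 2 : ℝ) *
        (x ^ (1 / 4 : ℝ) * x ^ (1 / 2 : ℝ) * x ^ (1 / 2 : ℝ) * x * x ^ (-(4 : ℝ))) := by ring
    _ ≤ 2 * F * t ^ (3 / 2 : ℝ) * 1 := by gcongr
    _ = _ := mul_one _

/-- **The regime `D'x^{1/2+η} ≥ y`** (`K = ⌈D'x^{1/2+η}/y⌉`, Lemma 3.3 for the head, IBP for the tail):
`∑_{d ≤ D'} d|E_d| ≤ (128√2 c x^{11/8+η+5ε₃/2}/y + 32 n! M) D'^{3/2}` — FI (3.13) with explicit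
constants and `ε` bookkeeping. [cite: FriedlanderIwaniecAnnals1998, §3 (3.13)] -/
theorem sum_mul_abs_fiE_le_of_large {ε₃ c : ℝ} (hε₃ : 0 < ε₃) (hε₃1 : ε₃ ≤ 1) (hc0 : 0 < c)
    (hc : ∀ (D K L : ℕ) (ξ : ℕ → ℕ → ℂ),
      ∑ d ∈ Finset.Icc 1 D, ‖∑ k ∈ Finset.Icc 1 K, ∑ ℓ ∈ Finset.Icc 1 L, ξ k ℓ * fiWeyl k ℓ d‖ ≤
        c * ((D : ℝ) * K * L) ^ ε₃ * ((D : ℝ) + Real.sqrt ((D : ℝ) * K * L)) *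
          Real.sqrt (∑ k ∈ Finset.Icc 1 K, ∑ ℓ ∈ Finset.Icc 1 L, ‖ξ k ℓ‖ ^ 2))
    {x y η : ℝ} (hx : 1 ≤ x) (hη : 0 < η) (hxy : x ^ (1 / 2 + η) ≤ y) (hyx : y ≤ x)
    {n : ℕ} (hn : 2 ≤ n) (hηn : 4 ≤ η * n) {M : ℝ} (hM0 : 0 ≤ M)
    (hM : ∀ i ≤ n, ∀ s : ℝ, ‖iteratedFDeriv ℝ i Real.smoothTransition s‖ ≤ M) {D' : ℕ}
    (hD'x : (D' : ℝ) ≤ x) (hlarge : y ≤ (D' : ℝ) * x ^ (1 / 2 + η)) :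
    ∑ d ∈ Icc 1 D', (d : ℝ) * |fiE x y d| ≤
      (128 * Real.sqrt 2 * c * x ^ (11 / 8 + η + 5 / 2 * ε₃) / y + 32 * n.factorial * M) *
        (D' : ℝ) ^ (3 / 2 : ℝ) := by
  have hx0 : 0 < x := by linarith
  have hxη : 0 < x ^ (1 / 2 + η) := Real.rpow_pos_of_pos hx0 _
  have hy0 : 0 < y := hxη.trans_le hxy
  have hD'0 : (0 : ℝ) < D' := by
    rcases Nat.eq_zero_or_pos D' with rfl | h
    · simp at hlarge; linarith
    · exact_mod_cast h
  have hC₁x := natSqrtSqrt_le_rpow hx0.le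
  set C₁ := Nat.sqrt (Nat.sqrt ⌊x⌋₊) with hC₁
  have hC₁0 : (0 : ℝ) ≤ C₁ := Nat.cast_nonneg _
  -- the parameter `K`
  set K₀ : ℝ := (D' : ℝ) * x ^ (1 / 2 + η) / y with hK₀
  have hK₀1 : 1 ≤ K₀ := by rw [hK₀, le_div_iff₀ hy0, one_mul]; exact hlarge
  have hK₀D : K₀ ≤ D' := by
    rw [hK₀, div_le_iff₀ hy0]
    exact mul_le_mul_of_nonneg_left hxy hD'0.le
  set K : ℕ := ⌈K₀⌉₊ with hK
  have hKK₀ : K₀ ≤ K := Nat.le_ceil K₀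
  have hK1 : 1 ≤ K := by
    have : (1 : ℝ) ≤ K := hK₀1.trans hKK₀
    exact_mod_cast this
  have hKr0 : (0 : ℝ) < K := by exact_mod_cast hK1
  have hK2 : (K : ℝ) ≤ 2 * K₀ := by
    have := (Nat.ceil_lt_add_one (by linarith : (0 : ℝ) ≤ K₀)).le
    rw [← hK] at this
    linarith
  have hKx : (K : ℝ) ≤ 2 * x := hK2.trans (by linarith [hK₀D.trans hD'x])
  -- Step 1: pointwise and summed
  set Lb : ℝ := 2 * Real.sqrt x * (n.factorial * M * (2 * Real.sqrt x / y) ^ n) with hLb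
  have hLb0 : 0 ≤ Lb := by positivity
  set w : ℝ := 4 * C₁ * (2 * Lb * ((K : ℝ) ^ (n - 1))⁻¹) with hw
  have hw0 : 0 ≤ w := by positivity
  have hpt : ∀ d ∈ Icc 1 D', (d : ℝ) * |fiE x y d| ≤
      4 * ‖∑ k ∈ Icc 1 K, ∑ c ∈ Icc 1 C₁,
        fiWeyl k (c ^ 2) d * 𝓕 (fiProfileC x y ((c : ℝ) ^ 4)) ((k : ℝ) / d)‖ +
      (d : ℝ) * ((d : ℝ) / (2 * π)) ^ n * w := by
    intro d hd
    rw [Finset.mem_Icc] at hd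
    have := mul_abs_fiE_le hx hy0 hyx (d := d) (by omega) hn hM0 hM hK1
    refine this.trans (le_of_eq ?_)
    rw [hw, hLb]; ring
  have hosc := sum_norm_oscillatory_le (ε := ε₃) hc0 hc hx0 hy0 hK1 C₁ D'
  set Q : ℝ := (D' : ℝ) * K * (C₁ ^ 2 : ℕ) with hQ
  have hsum : ∑ d ∈ Icc 1 D', (d : ℝ) * |fiE x y d| ≤
      4 * (Real.sqrt x * (c * Q ^ ε₃ * ((D' : ℝ) + Real.sqrt Q) * Real.sqrt (2 * C₁) *
        (4 * Real.sqrt K))) + (D' : ℝ) * ((D' : ℝ) * ((D' : ℝ) / (2 * π)) ^ n * w) := by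
    refine (sum_le_sum hpt).trans ?_
    rw [sum_add_distrib, ← mul_sum]
    exact add_le_add (mul_le_mul_of_nonneg_left hosc (by norm_num)) (sum_mul_pow_div_le hw0 n D')
  refine hsum.trans ?_
  -- Step 2: the head
  have hQ0 : 0 ≤ Q := by positivity
  have hC₁2 : ((C₁ ^ 2 : ℕ) : ℝ) ≤ x ^ (1 / 2 : ℝ) := by
    push_cast
    calc (C₁ : ℝ) ^ 2 ≤ (x ^ (1 / 4 : ℝ)) ^ 2 := pow_le_pow_left₀ hC₁0 hC₁x 2
      _ = x ^ (1 / 2 : ℝ) := by rw [← Real.rpow_natCast, ← Real.rpow_mul hx0.le]; norm_num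
  have hQle : Q ≤ 2 * x ^ (5 / 2 : ℝ) := by
    calc Q ≤ x * (2 * x) * x ^ (1 / 2 : ℝ) := by
          rw [hQ]
          exact mul_le_mul (mul_le_mul hD'x hKx hKr0.le hx0.le) hC₁2 (by positivity)
            (by positivity)
      _ = 2 * x ^ (5 / 2 : ℝ) := by
          rw [show (5 / 2 : ℝ) = 1 + 1 + 1 / 2 by norm_num, Real.rpow_add hx0, Real.rpow_add hx0,
            Real.rpow_one]
          ring
  have hQε : Q ^ ε₃ ≤ 2 * x ^ (5 / 2 * ε₃) := rpow_eps_le hx0 hQ0 hQle hε₃ hε₃1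
  have hQ' : Q = (D' : ℝ) * K * (C₁ : ℝ) ^ 2 := by rw [hQ]; push_cast; ring
  have hhead : ((D' : ℝ) + Real.sqrt Q) * (4 * Real.sqrt K) ≤
      14 * ((D' : ℝ) ^ (3 / 2 : ℝ) * (x ^ (3 / 4 + η) / y)) := by
    rw [hQ']
    exact head_factor_le hx hy0 hyx hη.le hD'0 hKr0.le hK2 hC₁0 hC₁x
  have hC₁s : Real.sqrt (2 * C₁) ≤ Real.sqrt 2 * x ^ (1 / 8 : ℝ) := by
    rw [Real.sqrt_mul (by norm_num)]
    gcongr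
    calc Real.sqrt C₁ ≤ Real.sqrt (x ^ (1 / 4 : ℝ)) := Real.sqrt_le_sqrt hC₁x
      _ = x ^ (1 / 8 : ℝ) := by
          rw [Real.sqrt_eq_rpow, ← Real.rpow_mul hx0.le]; norm_num
  have hxprod : x ^ (1 / 2 : ℝ) * x ^ (5 / 2 * ε₃) * x ^ (1 / 8 : ℝ) * x ^ (3 / 4 + η) =
      x ^ (11 / 8 + η + 5 / 2 * ε₃) := by
    rw [← Real.rpow_add hx0, ← Real.rpow_add hx0, ← Real.rpow_add hx0]; ring_nf
  have hH : 4 * (Real.sqrt x * (c * Q ^ ε₃ * ((D' : ℝ) + Real.sqrt Q) * Real.sqrt (2 * C₁) *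
      (4 * Real.sqrt K))) ≤ 128 * Real.sqrt 2 * c * x ^ (11 / 8 + η + 5 / 2 * ε₃) / y *
        (D' : ℝ) ^ (3 / 2 : ℝ) := by
    have e1 : 4 * (Real.sqrt x * (c * Q ^ ε₃ * ((D' : ℝ) + Real.sqrt Q) * Real.sqrt (2 * C₁) *
        (4 * Real.sqrt K))) = 4 * Real.sqrt x * c * (Q ^ ε₃ * (Real.sqrt (2 * C₁) *
          (((D' : ℝ) + Real.sqrt Q) * (4 * Real.sqrt K)))) := by ring
    have e2 : 4 * Real.sqrt x * c * ((2 * x ^ (5 / 2 * ε₃)) * ((Real.sqrt 2 * x ^ (1 / 8 : ℝ)) *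
        (14 * ((D' : ℝ) ^ (3 / 2 : ℝ) * (x ^ (3 / 4 + η) / y))))) =
        112 * Real.sqrt 2 * c * x ^ (11 / 8 + η + 5 / 2 * ε₃) / y * (D' : ℝ) ^ (3 / 2 : ℝ) := by
      rw [← hxprod, Real.sqrt_eq_rpow]; ring
    rw [e1]
    have hstep : Q ^ ε₃ * (Real.sqrt (2 * C₁) * (((D' : ℝ) + Real.sqrt Q) * (4 * Real.sqrt K))) ≤
        (2 * x ^ (5 / 2 * ε₃)) * ((Real.sqrt 2 * x ^ (1 / 8 : ℝ)) *
          (14 * ((D' : ℝ) ^ (3 / 2 : ℝ) * (x ^ (3 / 4 + η) / y)))) := by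
      refine mul_le_mul hQε (mul_le_mul hC₁s hhead (by positivity) (by positivity))
        (by positivity) (by positivity)
    calc 4 * Real.sqrt x * c * (Q ^ ε₃ * (Real.sqrt (2 * C₁) *
          (((D' : ℝ) + Real.sqrt Q) * (4 * Real.sqrt K))))
        ≤ 4 * Real.sqrt x * c * ((2 * x ^ (5 / 2 * ε₃)) * ((Real.sqrt 2 * x ^ (1 / 8 : ℝ)) *
          (14 * ((D' : ℝ) ^ (3 / 2 : ℝ) * (x ^ (3 / 4 + η) / y))))) :=
          mul_le_mul_of_nonneg_left hstep (by positivity)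
      _ = 112 * Real.sqrt 2 * c * x ^ (11 / 8 + η + 5 / 2 * ε₃) / y * (D' : ℝ) ^ (3 / 2 : ℝ) := e2
      _ ≤ 128 * Real.sqrt 2 * c * x ^ (11 / 8 + η + 5 / 2 * ε₃) / y * (D' : ℝ) ^ (3 / 2 : ℝ) := by
          gcongr; norm_num
  -- Step 3: the tail
  set a : ℝ := 2 * Real.sqrt x / y * ((D' : ℝ) / (2 * π)) with ha
  have ha0 : 0 ≤ a := by positivity
  have haK : a / K ≤ x ^ (-η) := by
    have h1 : a / K ≤ a / K₀ := div_le_div_of_nonneg_left ha0 (by linarith) hKK₀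
    refine h1.trans ?_
    rw [div_le_iff₀ (by linarith)]
    have hxs : Real.sqrt x = x ^ (1 / 2 : ℝ) := Real.sqrt_eq_rpow x
    have e : x ^ (-η) * K₀ = x ^ (1 / 2 : ℝ) * D' / y := by
      rw [hK₀, show x ^ (-η) * ((D' : ℝ) * x ^ (1 / 2 + η) / y) =
        (x ^ (-η) * x ^ (1 / 2 + η)) * D' / y by ring, ← Real.rpow_add hx0]
      ring_nf
    rw [e, ha, hxs, show 2 * x ^ (1 / 2 : ℝ) / y * ((D' : ℝ) / (2 * π)) =
      x ^ (1 / 2 : ℝ) * D' / y * (1 / π) by field_simp]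
    refine mul_le_of_le_one_right (by positivity) ?_
    rw [div_le_one Real.pi_pos]
    linarith [Real.pi_gt_three]
  have haKn : (a / K) ^ n ≤ x ^ (-(4 : ℝ)) := pow_le_rpow_neg_four hx (by positivity) haK hηn
  have hT : (D' : ℝ) * ((D' : ℝ) * ((D' : ℝ) / (2 * π)) ^ n * w) ≤
      32 * n.factorial * M * (D' : ℝ) ^ (3 / 2 : ℝ) := by
    have hKn : (K : ℝ) * (a / K) ^ n = a ^ n * ((K : ℝ) ^ (n - 1))⁻¹ := by
      have hK0' : (K : ℝ) ≠ 0 := hKr0.ne'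
      rw [div_pow]
      obtain ⟨m, hm⟩ : ∃ m, n = m + 1 := ⟨n - 1, by omega⟩
      rw [hm, Nat.add_sub_cancel, pow_succ (K : ℝ) m]
      field_simp
    have e1 : (D' : ℝ) * ((D' : ℝ) * ((D' : ℝ) / (2 * π)) ^ n * w) =
        (16 * n.factorial * M) * (C₁ * Real.sqrt x * (D' : ℝ) ^ 2 * (K * (a / K) ^ n)) := by
      rw [hKn, hw, hLb, ha, mul_pow, sq]
      ring
    rw [e1]
    have := tail_factor_le hx hD'0 hD'x hKr0.le hKx hC₁x (by positivity) haKn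
      (F := 16 * n.factorial * M) (by positivity)
    linarith
  calc _ ≤ 128 * Real.sqrt 2 * c * x ^ (11 / 8 + η + 5 / 2 * ε₃) / y * (D' : ℝ) ^ (3 / 2 : ℝ) +
        32 * n.factorial * M * (D' : ℝ) ^ (3 / 2 : ℝ) := add_le_add hH hT
    _ = _ := by ring

/-- **(3.13) ⇒ `∑_{d ≤ D} |E_d| ≤ 7 (128√2 c x^{11/8+η+5ε₃/2}/y + 32 n! M) √D`** for `D ≤ x`,
`x^{1/2+η} ≤ y ≤ x` (both regimes and the dyadic step).
[cite: FriedlanderIwaniecAnnals1998, §3, "(3.13) … This implies ∑_{d ≤ D} |A_d(f) - M_d(f)| ≪ D^{1/2} x^{11/8+ε} y^{-1}"] -/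
theorem sum_abs_fiE_le {ε₃ c : ℝ} (hε₃ : 0 < ε₃) (hε₃1 : ε₃ ≤ 1) (hc0 : 0 < c)
    (hc : ∀ (D K L : ℕ) (ξ : ℕ → ℕ → ℂ),
      ∑ d ∈ Finset.Icc 1 D, ‖∑ k ∈ Finset.Icc 1 K, ∑ ℓ ∈ Finset.Icc 1 L, ξ k ℓ * fiWeyl k ℓ d‖ ≤
        c * ((D : ℝ) * K * L) ^ ε₃ * ((D : ℝ) + Real.sqrt ((D : ℝ) * K * L)) *
          Real.sqrt (∑ k ∈ Finset.Icc 1 K, ∑ ℓ ∈ Finset.Icc 1 L, ‖ξ k ℓ‖ ^ 2))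
    {x y η : ℝ} (hx : 1 ≤ x) (hη : 0 < η) (hxy : x ^ (1 / 2 + η) ≤ y) (hyx : y ≤ x)
    {n : ℕ} (hn : 2 ≤ n) (hηn : 4 ≤ η * n) {M : ℝ} (hM0 : 0 ≤ M)
    (hM : ∀ i ≤ n, ∀ s : ℝ, ‖iteratedFDeriv ℝ i Real.smoothTransition s‖ ≤ M) {D : ℕ}
    (hDx : (D : ℝ) ≤ x) :
    ∑ d ∈ Icc 1 D, |fiE x y d| ≤
      7 * (128 * Real.sqrt 2 * c * x ^ (11 / 8 + η + 5 / 2 * ε₃) / y + 32 * n.factorial * M) *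
        Real.sqrt D := by
  have hx0 : 0 < x := by linarith
  have hy0 : 0 < y := (Real.rpow_pos_of_pos hx0 _).trans_le hxy
  set A : ℝ := 128 * Real.sqrt 2 * c * x ^ (11 / 8 + η + 5 / 2 * ε₃) / y + 32 * n.factorial * M
    with hA
  have hA32 : 32 * n.factorial * M ≤ A := by
    have : 0 ≤ 128 * Real.sqrt 2 * c * x ^ (11 / 8 + η + 5 / 2 * ε₃) / y := by positivity
    linarith
  have hA0 : 0 ≤ A := le_trans (by positivity) hA32
  refine dyadic_bound (fun d => abs_nonneg _) hA0 D fun D' hD'1 hD'D => ?_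
  have hD'x : (D' : ℝ) ≤ x := le_trans (by exact_mod_cast hD'D) hDx
  rcases le_total y ((D' : ℝ) * x ^ (1 / 2 + η)) with hlarge | hsmall
  · exact sum_mul_abs_fiE_le_of_large hε₃ hε₃1 hc0 hc hx hη hxy hyx hn hηn hM0 hM hD'x hlarge
  · calc ∑ d ∈ Icc 1 D', (d : ℝ) * |fiE x y d| ≤ 32 * n.factorial * M * (D' : ℝ) ^ (3 / 2 : ℝ) :=
          sum_mul_abs_fiE_le_of_small hx hy0 hyx hn hηn hM0 hM hD'x hsmall
      _ ≤ A * (D' : ℝ) ^ (3 / 2 : ℝ) := mul_le_mul_of_nonneg_right hA32 (by positivity)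

end Literature.NumberTheory.Sieve.FriedlanderIwaniecPrimes
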